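import Summits.QuantumAdvantage.AdviceFreeQNC0.RegisterChainLocal
import HarnessLib

/-!
# Cell qa-qnc0, `p = 3` — the register chain with ABSTRACT BELL EVALUATORS: site signs, final vector, pointwise identity

`RegisterChainLocal.lean` (qn-prover-3 g22) runs the register chain for an `r`-local LETTER rule `t` (`IsLocalRule`): the only place
where locality enters is the evaluation of the bells — the middle bell `i − r` from the state at site `i` (`epsMid`, `midLetters`)
and the boundary bells from the prefix and the final state (`fFin`, `finLetters`).  Everything else (letter phases, the decoded
walk states `backPos` / `stFwd`, the resolution over the final state) is frame-independent.

This file abstracts the two evaluators: a walk strategy `Y : Fin (n+1) → (Fin n → Bool) → Bool` (ANY frame) together with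
* a MIDDLE evaluator `em i σ b` claiming the value of bell `i − r` from the chain state before letter `i` and the letter (`MidSpec`:
  correct on the true trajectory `stU r u i`, `xs u i` for `2r ≤ i < n`), and
* a FINAL evaluator `ef a σ k` claiming the boundary bells `k < r`, `n − r ≤ k ≤ n` from the letter prefix `a` and the final state
  (`FinSpec`),
gives site weights `WaE`, a final vector `fFinE` and **the pointwise identity `pointwise_eqE`**:
`e₃(γ·x(u)) · [st u n = τ] · Π_g (−1)^{[Y g u ∧ κ + st u g + τ ≠ 0]} = Σ_a pathW (WaE a) (fFinE a) (letters of u)`.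
Instances: `r`-local letter rules (g22), WALK-window-local and hidden-state-aware rules (`TwistBoundStateLocal.lean`).

WHAT THIS IS NOT: no bound here (`TwistBoundEval.lean`); crux 22907 untouched; no separation.
-/

noncomputable section

namespace Summit.QuantumAdvantage.AdviceFreeQNC0

open Finset Literature.Computability.MetaComplexity Literature.Computability.QuantumComplexity

namespace BondTwist3

open TransferWalk ConstBells TwistedTransfer

variable {n r : ℕ}

/-! ## Evaluators and their specifications -/

/-- The `ℕ`-indexed strategy (`false` beyond the cuts). -/
def yN (Y : Fin (n + 1) → (Fin n → Bool) → Bool) (k : ℕ) (u : Fin n → Bool) : Bool :=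
  if h : k < n + 1 then Y ⟨k, h⟩ u else false

/-- `yN` at a cut. -/
theorem yN_fin (Y : Fin (n + 1) → (Fin n → Bool) → Bool) (g : Fin (n + 1)) (u : Fin n → Bool) : yN Y g.val u = Y g u := by
  unfold yN; rw [dif_pos g.isLt]

/-- The middle evaluator is CORRECT: at site `i` (`2r ≤ i < n`) of the true trajectory it returns bell `i − r`. -/
def MidSpec (Y : Fin (n + 1) → (Fin n → Bool) → Bool) (em : ℕ → RegState r → Bool → Bool) : Prop :=
  ∀ (u : Fin n → Bool) (i : ℕ), 2 * r ≤ i → i < n → em i (stU r u i) (xs u i) = yN Y (i - r) u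

/-- The final evaluator is CORRECT: from the letter prefix `a` of `u` and the final state it returns the boundary bells. -/
def FinSpec (Y : Fin (n + 1) → (Fin n → Bool) → Bool) (ef : (Fin (2 * r) → Bool) → RegState r → ℕ → Bool) : Prop :=
  ∀ (a : Fin (2 * r) → Bool) (u : Fin n → Bool), 4 * r + 3 ≤ n → HasPrefix a u →
    ∀ k : ℕ, k ≤ n → (k < r ∨ n ≤ k + r) → ef a (stU r u n) k = yN Y k u

/-- The empty strategy has the trivial evaluators. -/
theorem midSpec_empty : MidSpec (r := r) (fun (_ : Fin (n + 1)) (_ : Fin n → Bool) => false) (fun _ _ _ => false) := by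
  intro u i _ _; unfold yN; split_ifs <;> rfl

/-- The empty strategy has the trivial evaluators. -/
theorem finSpec_empty : FinSpec (r := r) (fun (_ : Fin (n + 1)) (_ : Fin n → Bool) => false) (fun _ _ _ => false) := by
  intro a u _ _ k _ _; unfold yN; split_ifs <;> rfl

/-! ## Middle sites -/

/-- The sign pattern of the middle site `i`: the evaluated bell `i − r`, charged at the decoded walk state `backPos σ r`. -/
def epsE (em : ℕ → RegState r → Bool → Bool) (κ τ : ZMod 3) (i : ℕ) (σ : RegState r) (b : Bool) : Bool :=
  decide (em i σ b = true ∧ κ + backPos σ r + τ ≠ 0)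

/-- **The middle sign is the sign of bell `i − r`** (`2r ≤ i < n`). -/
theorem epsE_spec {Y : Fin (n + 1) → (Fin n → Bool) → Bool} {em : ℕ → RegState r → Bool → Bool} (hm : MidSpec Y em)
    (κ τ : ZMod 3) (u : Fin n → Bool) {i : ℕ} (h2r : 2 * r ≤ i) (hi : i < n) :
    (if epsE em κ τ i (stU r u i) (xs u i) = true then (-1 : ℂ) else 1) = sgnF (yN Y (i - r) u) κ (st u (i - r)) τ := by
  have hpos : backPos (stU r u i) r = st u (i - r) := backPos_stU u hi.le r (by omega) (by omega)
  unfold epsE sgnF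
  rw [hm u i h2r hi, hpos]
  by_cases h : yN Y (i - r) u = true ∧ κ + st u (i - r) + τ ≠ 0
  · rw [decide_eq_true h, if_pos rfl, if_pos h]
  · rw [decide_eq_false h, if_neg (by decide), if_neg h]

/-! ## The final vector -/

/-- **The final vector** of prefix `a` and guess `τ`: last-letter phase, final-state indicator, evaluated boundary-bell signs. -/
def fFinE (γ : Fin (n + 1) → ZMod 3) (ef : (Fin (2 * r) → Bool) → RegState r → ℕ → Bool) (κ τ : ZMod 3)
    (a : Fin (2 * r) → Bool) (σ : RegState r) : ℂ :=
  (if σ.2.1 then phase γ n else 1) * (if -σ.1 = τ then 1 else 0) *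
    ((∏ k ∈ range r, sgnF (ef a σ k) κ (posB n a σ k) τ) *
     (∏ k ∈ Ico (n - r) (n + 1), sgnF (ef a σ k) κ (posB n a σ k) τ))

/-- The final vector is pointwise bounded by `1`. -/
theorem norm_fFinE_le (γ : Fin (n + 1) → ZMod 3) (ef : (Fin (2 * r) → Bool) → RegState r → ℕ → Bool) (κ τ : ZMod 3)
    (a : Fin (2 * r) → Bool) (σ : RegState r) : ‖fFinE γ ef κ τ a σ‖ ≤ 1 := by
  unfold fFinE
  rw [norm_mul, norm_mul, norm_mul]
  have h1 : ‖(if σ.2.1 then phase γ n else 1 : ℂ)‖ ≤ 1 := by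
    split_ifs
    · exact norm_phase_le_one γ n
    · simp
  have h2 : ‖(if -σ.1 = τ then (1 : ℂ) else 0)‖ ≤ 1 := by split_ifs <;> simp
  have h3 := norm_prod_sgnF_le (range r) (fun k => ef a σ k) κ τ (posB n a σ)
  have h4 := norm_prod_sgnF_le (Ico (n - r) (n + 1)) (fun k => ef a σ k) κ τ (posB n a σ)
  exact mul_le_one₀ (mul_le_one₀ h1 (norm_nonneg _) h2) (by positivity) (mul_le_one₀ h3 (norm_nonneg _) h4)

/-- **The final vector on the true trajectory** (`4r + 3 ≤ n`, prefix `a`). -/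
theorem fFinE_spec {Y : Fin (n + 1) → (Fin n → Bool) → Bool} {ef : (Fin (2 * r) → Bool) → RegState r → ℕ → Bool}
    (hf : FinSpec Y ef) (γ : Fin (n + 1) → ZMod 3) (κ τ : ZMod 3) {a : Fin (2 * r) → Bool} (u : Fin n → Bool)
    (hn : 4 * r + 3 ≤ n) (ha : HasPrefix a u) :
    fFinE γ ef κ τ a (stU r u n) =
      (if xs u n then phase γ n else 1) * (if st u n = τ then 1 else 0) *
        ((∏ k ∈ range r, sgnF (yN Y k u) κ (st u k) τ) *
         (∏ k ∈ Ico (n - r) (n + 1), sgnF (yN Y k u) κ (st u k) τ)) := by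
  have hspin : (stU r u n).2.1 = xs u n := by rw [xs_last u]; rfl
  have hposS : (stU r u n).1 = -st u n := rfl
  unfold fFinE
  rw [hspin, hposS, neg_neg]
  congr 1
  have hstart : ∀ k ∈ range r, sgnF (ef a (stU r u n) k) κ (posB n a (stU r u n) k) τ = sgnF (yN Y k u) κ (st u k) τ := by
    intro k hk
    rw [mem_range] at hk
    rw [hf a u hn ha k (by omega) (Or.inl hk)]
    unfold posB
    rw [if_pos hk, stFwd_eq (by omega) ha k (by omega)]
  have hend : ∀ k ∈ Ico (n - r) (n + 1), sgnF (ef a (stU r u n) k) κ (posB n a (stU r u n) k) τ =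
      sgnF (yN Y k u) κ (st u k) τ := by
    intro k hk
    rw [mem_Ico] at hk
    rw [hf a u hn ha k (by omega) (Or.inr (by omega))]
    unfold posB
    rw [if_neg (by omega), backPos_stU u le_rfl (n - k) (by omega) (by omega), show n - (n - k) = k by omega]
  rw [prod_congr rfl hstart, prod_congr rfl hend]

/-! ## The site weights -/

/-- **The site weights** of prefix `a`: prefix indicator (sites `< 2r`) or middle sign (sites `≥ 2r`), times the letter phase. -/
def WaE (γ : Fin (n + 1) → ZMod 3) (em : ℕ → RegState r → Bool → Bool) (κ τ : ZMod 3)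
    (a : Fin (2 * r) → Bool) (i : ℕ) (σ : RegState r) (b : Bool) : ℂ :=
  (if i < 2 * r then (if b = aExt a i then (1 : ℂ) else 0) else (if epsE em κ τ i σ b then -1 else 1)) *
    (if b then phase γ i else 1)

/-- The site weights have norm `≤ 1`. -/
theorem norm_WaE_le (γ : Fin (n + 1) → ZMod 3) (em : ℕ → RegState r → Bool → Bool) (κ τ : ZMod 3)
    (a : Fin (2 * r) → Bool) (i : ℕ) (σ : RegState r) (b : Bool) : ‖WaE γ em κ τ a i σ b‖ ≤ 1 := by
  unfold WaE
  rw [norm_mul]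
  have h1 : ‖(if i < 2 * r then (if b = aExt a i then (1 : ℂ) else 0) else (if epsE em κ τ i σ b then -1 else 1))‖ ≤ 1 := by
    split_ifs <;> simp
  have h2 : ‖(if b then phase γ i else 1 : ℂ)‖ ≤ 1 := by
    split_ifs
    · exact norm_phase_le_one γ i
    · simp
  exact mul_le_one₀ h1 (norm_nonneg _) h2

/-- Beyond the prefix the site weights are of sign-and-phase form. -/
theorem WaE_eq_signW (γ : Fin (n + 1) → ZMod 3) (em : ℕ → RegState r → Bool → Bool) (κ τ : ZMod 3)
    (a : Fin (2 * r) → Bool) {i : ℕ} (hi : 2 * r ≤ i) : WaE γ em κ τ a i = signW (phase γ i) (epsE em κ τ i) := by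
  funext σ b
  unfold WaE signW
  rw [if_neg (by omega)]

/-! ## The pointwise identity -/

/-- The path weight of a non-matching prefix vanishes (`2r ≤ n`). -/
theorem pathW_WaE_eq_zero_of_ne (γ : Fin (n + 1) → ZMod 3) (em : ℕ → RegState r → Bool → Bool)
    (ef : (Fin (2 * r) → Bool) → RegState r → ℕ → Bool) (κ τ : ZMod 3)
    {a : Fin (2 * r) → Bool} (u : Fin n → Bool) (hrn : 2 * r ≤ n) (ha : a ≠ prefixOf r u) :
    pathW (WaE γ em κ τ a) (fFinE γ ef κ τ a) 0 (initState r) n (xs u) = 0 := by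
  obtain ⟨m, hm⟩ := Function.ne_iff.1 ha
  unfold pathW
  apply mul_eq_zero_of_left
  apply Finset.prod_eq_zero (mem_range.2 (show m.val < n by omega))
  unfold WaE
  rw [zero_add, if_pos m.isLt]
  have hne : xs u m.val ≠ aExt a m.val := by
    unfold aExt; rw [dif_pos m.isLt]; intro h; exact hm (h ▸ rfl)
  rw [if_neg hne, zero_mul]

/-- **THE POINTWISE IDENTITY** for evaluated strategies (`4r + 3 ≤ n`). -/
theorem pointwise_eqE {Y : Fin (n + 1) → (Fin n → Bool) → Bool} {em : ℕ → RegState r → Bool → Bool}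
    {ef : (Fin (2 * r) → Bool) → RegState r → ℕ → Bool} (hem : MidSpec Y em) (hf : FinSpec Y ef)
    (γ : Fin (n + 1) → ZMod 3) (κ τ : ZMod 3) (hn : 4 * r + 3 ≤ n) (u : Fin n → Bool) :
    (ZMod.stdAddChar (∑ i : Fin (n + 1), if xOfU u i then γ i else 0) : ℂ) *
        ((if st u n = τ then (1 : ℂ) else 0) * ∏ g : Fin (n + 1), sgnF (Y g u) κ (st u g.val) τ) =
      ∑ a : Fin (2 * r) → Bool, pathW (WaE γ em κ τ a) (fFinE γ ef κ τ a) 0 (initState r) n (xs u) := by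
  classical
  rw [Finset.sum_eq_single (prefixOf r u)
    (fun a _ ha => pathW_WaE_eq_zero_of_ne γ em ef κ τ u (by omega) ha) (fun h => absurd (mem_univ _) h)]
  set a := prefixOf r u with haDef
  have ha : HasPrefix a u := hasPrefix_prefixOf u
  unfold pathW
  rw [traj_xs u n le_rfl, fFinE_spec hf γ κ τ u hn ha]
  have htraj : ∀ m ∈ range n, WaE γ em κ τ a (0 + m) (traj (xs u) (initState r) m) (xs u m) =
      (if m < 2 * r then (1 : ℂ) else sgnF (yN Y (m - r) u) κ (st u (m - r)) τ) *
        (if xs u m then phase γ m else 1) := by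
    intro m hm
    rw [mem_range] at hm
    rw [zero_add, traj_xs u m hm.le]
    unfold WaE
    by_cases h2 : m < 2 * r
    · rw [if_pos h2, if_pos h2, if_pos (ha m h2)]
    · rw [if_neg h2, if_neg h2, epsE_spec hem κ τ u (by omega) hm]
  rw [prod_congr rfl htraj, prod_mul_distrib]
  have hphase : (∏ m ∈ range n, (if xs u m then phase γ m else 1 : ℂ)) * (if xs u n then phase γ n else 1) =
      (ZMod.stdAddChar (∑ i : Fin (n + 1), if xOfU u i then γ i else 0) : ℂ) := by
    rw [char_eq_prod, ← Finset.prod_range_succ (fun m => (if xs u m then phase γ m else 1 : ℂ)) n,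
      ← Fin.prod_univ_eq_prod_range (fun m => (if xs u m then phase γ m else 1 : ℂ)) (n + 1)]
    refine prod_congr rfl fun i _ => ?_
    have : xs u i.val = xOfU u i := by unfold xs; rw [dif_pos i.isLt]
    rw [this]
  have hmid : (∏ m ∈ range n, (if m < 2 * r then (1 : ℂ) else sgnF (yN Y (m - r) u) κ (st u (m - r)) τ)) =
      ∏ k ∈ Ico r (n - r), sgnF (yN Y k u) κ (st u k) τ := by
    rw [range_eq_Ico, ← prod_Ico_consecutive _ (Nat.zero_le (2 * r)) (show 2 * r ≤ n by omega)]
    have h1 : (∏ m ∈ Ico 0 (2 * r), (if m < 2 * r then (1 : ℂ) else sgnF (yN Y (m - r) u) κ (st u (m - r)) τ)) = 1 :=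
      prod_eq_one fun m hm => by rw [mem_Ico] at hm; rw [if_pos hm.2]
    have h2 : (∏ m ∈ Ico (2 * r) n, (if m < 2 * r then (1 : ℂ) else sgnF (yN Y (m - r) u) κ (st u (m - r)) τ)) =
        ∏ m ∈ Ico (2 * r) n, sgnF (yN Y (m - r) u) κ (st u (m - r)) τ :=
      prod_congr rfl fun m hm => by rw [mem_Ico] at hm; rw [if_neg (by omega)]
    rw [h1, one_mul, h2]
    exact prod_Ico_shift (fun k => sgnF (yN Y k u) κ (st u k) τ) (by omega)
  have hall : (∏ g : Fin (n + 1), sgnF (Y g u) κ (st u g.val) τ) =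
      (∏ k ∈ range r, sgnF (yN Y k u) κ (st u k) τ) *
        ((∏ k ∈ Ico r (n - r), sgnF (yN Y k u) κ (st u k) τ) *
         (∏ k ∈ Ico (n - r) (n + 1), sgnF (yN Y k u) κ (st u k) τ)) := by
    have e1 : (∏ g : Fin (n + 1), sgnF (Y g u) κ (st u g.val) τ) =
        ∏ g : Fin (n + 1), sgnF (yN Y g.val u) κ (st u g.val) τ :=
      prod_congr rfl fun g _ => by rw [yN_fin]
    rw [e1, Fin.prod_univ_eq_prod_range (fun k => sgnF (yN Y k u) κ (st u k) τ) (n + 1), range_eq_Ico,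
      ← prod_Ico_consecutive _ (Nat.zero_le r) (show r ≤ n + 1 by omega),
      ← prod_Ico_consecutive _ (show r ≤ n - r by omega) (show n - r ≤ n + 1 by omega), ← range_eq_Ico]
  rw [hmid, hall, ← hphase]
  ring

end BondTwist3

end Summit.QuantumAdvantage.AdviceFreeQNC0

end
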